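import Summits.NavierStokesRegularity.NavierStokesRegularity.Theorems.FilamentSkeletonRssCoreLinearInvertibilityOddAttenuationEnergy

/-!
# Tools E for stub `stub_oddAttenuation` of crux `CoreLinearInvertibility`
# (stmt-NavierStokesRegularity-17973), line `Sketch`: the weighted (`|x|²`) estimate

The conjugated local operator `H̃u = Δu + λ x₀∂₀u − (κ|x|² + δx₀²) u + ((1+λ)/2) u − R Ω ∂_θu`
paired with `|x|² u`, for `u ∈ C²` of Gaussian decay with two derivatives:

* (W) `∫ (H̃u) |x|²u = −∫|x|²|∇u|² + 2∫u² + ½∫|x|²u² − λ∫x₀²u² − ∫(κ|x|² + δx₀²)|x|²u²`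
  (`∫ |x|² u Δu = −∫|x|²|∇u|² + 2∫u²`, `∫ x₀|x|² u ∂₀u = −½∫(|x|² + 2x₀²)u²`, `∫ |x|²Ω u ∂_θu = 0`);
* (W′) `∫ |x|²|∇u|² ≤ (∫(H̃u)²)/(4κ) + 2∫u² + ½∫|x|²u²` for `λ, δ ≥ 0`, `κ > 0`
  (Cauchy–Schwarz against `|x|²u` and absorption of `∫|x|⁴u²` into `κ ∫|x|⁴u² ≤ ∫ V|x|²u²`).
-/

set_option linter.dupNamespace false

noncomputable section

namespace Summit.NavierStokesRegularity.NavierStokesRegularity.Theorems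

open MeasureTheory Filter Topology Set
open Literature.Analysis.FluidPDE
open Summit.AnomalousDissipation.AnomalousDissipation.Theorems.MarginalStabilityChainStretchedVortexRows
open scoped InnerProductSpace Laplacian ContDiff

section Weighted

variable {u : EuclideanSpace ℝ (Fin 2) → ℝ} (hu : ContDiff ℝ 2 u)
  (hB : ∃ (C : ℝ) (N : ℕ), ∀ x, |u x| ≤ C * (1 + ‖x‖) ^ N * Real.exp (-(1 / 8 * ‖x‖ ^ 2)) ∧
      ‖fderiv ℝ u x‖ ≤ C * (1 + ‖x‖) ^ N * Real.exp (-(1 / 8 * ‖x‖ ^ 2)) ∧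
      ‖fderiv ℝ (fderiv ℝ u) x‖ ≤ C * (1 + ‖x‖) ^ N * Real.exp (-(1 / 8 * ‖x‖ ^ 2)))
  {lam κ δ R : ℝ} {f : EuclideanSpace ℝ (Fin 2) → ℝ}
  (hf : ∀ x, f x = Δ u x + lam * x 0 * fderiv ℝ u x (EuclideanSpace.single 0 1) -
      (κ * ‖x‖ ^ 2 + δ * x 0 ^ 2) * u x + (1 + lam) / 2 * u x -
      R * ((8 * Real.pi)⁻¹ * burgersPhi (‖x‖ ^ 2 / 4) * fderiv ℝ u x (perp x)))
  (hfc : Continuous f)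
  (hfB : ∃ (C : ℝ) (N : ℕ), ∀ x, |f x| ≤ C * (1 + ‖x‖) ^ N * Real.exp (-(1 / 8 * ‖x‖ ^ 2)))

include hu hB in
/-- `∫ |x|² u Δu = −∫ |x|²|∇u|² + 2∫ u²` (`∇|x|² = 2x`, `∫ xᵢ u ∂ᵢu = −½∫u²`). [folklore] -/
theorem integral_norm_sq_mul_mul_laplacian_eq :
    ∫ x, ‖x‖ ^ 2 * u x * Δ u x = -(∫ x, ‖x‖ ^ 2 * (fderiv ℝ u x (EuclideanSpace.single 0 1) ^ 2 +
      fderiv ℝ u x (EuclideanSpace.single 1 1) ^ 2)) + 2 * ∫ x, u x ^ 2 := by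
  have h := integral_mul_mul_laplacian_eq_of_gaussDecay hu hB (contDiff_norm_sq ℝ) polyBound_norm_sq
    polyBound_fderiv_norm_sq
  have hU := gaussDecay_self hB
  have hd : ∀ (x : EuclideanSpace ℝ (Fin 2)) (i : Fin 2),
      fderiv ℝ (fun y : EuclideanSpace ℝ (Fin 2) => ‖y‖ ^ 2) x (EuclideanSpace.single i 1) = 2 * x i := by
    intro x i
    rw [fderiv_norm_sq_apply', EuclideanSpace.inner_single_right]
    simp
  simp_rw [hd] at h
  have iW : Integrable fun x => ‖x‖ ^ 2 * (fderiv ℝ u x (EuclideanSpace.single 0 1) ^ 2 +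
      fderiv ℝ u x (EuclideanSpace.single 1 1) ^ 2) := by
    have hU0 := gaussDecay_fderiv_apply hB (EuclideanSpace.single 0 1)
    have hU1 := gaussDecay_fderiv_apply hB (EuclideanSpace.single 1 1)
    exact integrable_of_gaussDecay (by norm_num)
      ((continuous_norm.pow 2).mul ((continuous_fderiv_apply_of_contDiff_two hu _).pow 2 |>.add
        ((continuous_fderiv_apply_of_contDiff_two hu _).pow 2)))
      (gaussDecay_of_le_add
        (gaussDecay_of_le_poly_mul_mul polyBound_norm_sq hU0 hU0
          (H := fun x => ‖x‖ ^ 2 * fderiv ℝ u x (EuclideanSpace.single 0 1) ^ 2) fun x => abs_mul_sq_le _ _)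
        (gaussDecay_of_le_poly_mul_mul polyBound_norm_sq hU1 hU1
          (H := fun x => ‖x‖ ^ 2 * fderiv ℝ u x (EuclideanSpace.single 1 1) ^ 2) fun x => abs_mul_sq_le _ _)
        fun x => by rw [mul_add]; exact abs_add_le _ _)
  have iP : ∀ i : Fin 2, Integrable fun x => x i * u x * fderiv ℝ u x (EuclideanSpace.single i 1) := fun i =>
    integrable_of_gaussDecay (by norm_num)
      (((contDiff_coord i (n := 0)).continuous.mul hu.continuous).mul (continuous_fderiv_apply_of_contDiff_two hu _))
      (gaussDecay_of_le_poly_mul_mul (polyBound_coord i) hU (gaussDecay_fderiv_apply hB _)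
        fun x => by rw [abs_mul, abs_mul])
  have e2 : ∀ x, ‖x‖ ^ 2 * (fderiv ℝ u x (EuclideanSpace.single 0 1) ^ 2 +
      fderiv ℝ u x (EuclideanSpace.single 1 1) ^ 2) +
      u x * (2 * x 0 * fderiv ℝ u x (EuclideanSpace.single 0 1) + 2 * x 1 * fderiv ℝ u x (EuclideanSpace.single 1 1)) =
      ‖x‖ ^ 2 * (fderiv ℝ u x (EuclideanSpace.single 0 1) ^ 2 + fderiv ℝ u x (EuclideanSpace.single 1 1) ^ 2) +
      2 * (x 0 * u x * fderiv ℝ u x (EuclideanSpace.single 0 1)) +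
      2 * (x 1 * u x * fderiv ℝ u x (EuclideanSpace.single 1 1)) := fun x => by ring
  simp_rw [e2] at h
  have i1 : Integrable fun x => 2 * (x 0 * u x * fderiv ℝ u x (EuclideanSpace.single 0 1)) := (iP 0).const_mul 2
  have i2 : Integrable fun x => 2 * (x 1 * u x * fderiv ℝ u x (EuclideanSpace.single 1 1)) := (iP 1).const_mul 2
  have i12 : Integrable fun x => ‖x‖ ^ 2 * (fderiv ℝ u x (EuclideanSpace.single 0 1) ^ 2 +
      fderiv ℝ u x (EuclideanSpace.single 1 1) ^ 2) +
      2 * (x 0 * u x * fderiv ℝ u x (EuclideanSpace.single 0 1)) := iW.add i1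
  rw [integral_add i12 i2, integral_add iW i1, integral_const_mul, integral_const_mul,
    integral_coord_mul_mul_fderiv_eq hu hB 0, integral_coord_mul_mul_fderiv_eq hu hB 1] at h
  rw [h]
  ring

include hu hB in
/-- `∫ x₀|x|² u ∂₀u = −½ (∫|x|²u² + 2∫x₀²u²)` (`∂₀(x₀|x|²) = |x|² + 2x₀²`). [folklore] -/
theorem integral_coord_norm_sq_mul_mul_fderiv_eq :
    ∫ x, x 0 * ‖x‖ ^ 2 * u x * fderiv ℝ u x (EuclideanSpace.single 0 1) =
      -(1 / 2) * ((∫ x, ‖x‖ ^ 2 * u x ^ 2) + 2 * ∫ x, x 0 ^ 2 * u x ^ 2) := by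
  have hm : ContDiff ℝ 1 fun y : EuclideanSpace ℝ (Fin 2) => y 0 * ‖y‖ ^ 2 :=
    (contDiff_coord 0).mul (contDiff_norm_sq ℝ)
  have hd : ∀ x : EuclideanSpace ℝ (Fin 2), fderiv ℝ (fun y : EuclideanSpace ℝ (Fin 2) => y 0 * ‖y‖ ^ 2) x
      (EuclideanSpace.single 0 1) = ‖x‖ ^ 2 + 2 * x 0 ^ 2 := by
    intro x
    rw [fderiv_coord_mul_apply ((contDiff_norm_sq ℝ (n := 1)).differentiable one_ne_zero x),
      fderiv_norm_sq_apply', EuclideanSpace.inner_single_right]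
    simp
    ring
  have h := integral_mul_mul_fderiv_apply_eq_of_gaussDecay hu hB hm
    (polyBound_of_le_mul (polyBound_coord 0) polyBound_norm_sq fun x => (abs_mul _ _).le)
    (EuclideanSpace.single 0 1) ⟨3, 2, fun x => by
      rw [hd, abs_of_nonneg (by positivity)]
      have : x 0 ^ 2 ≤ ‖x‖ ^ 2 := by
        have h := abs_coord_le_norm_fin_two x 0
        nlinarith [abs_nonneg (x 0), sq_abs (x 0)]
      nlinarith [norm_nonneg x]⟩
  simp_rw [hd] at h
  rw [h]
  have hU := gaussDecay_self hB
  have iX : Integrable fun x => ‖x‖ ^ 2 * u x ^ 2 :=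
    integrable_of_gaussDecay (by norm_num) ((continuous_norm.pow 2).mul (hu.continuous.pow 2))
      (gaussDecay_of_le_poly_mul_mul polyBound_norm_sq hU hU fun x => abs_mul_sq_le _ _)
  have i0 : Integrable fun x => x 0 ^ 2 * u x ^ 2 :=
    integrable_of_gaussDecay (by norm_num) (((contDiff_coord 0 (n := 0)).continuous.pow 2).mul (hu.continuous.pow 2))
      (gaussDecay_of_le_poly_mul_mul (polyBound_of_le_mul (polyBound_coord 0) (polyBound_coord 0)
        (H := fun x => x 0 ^ 2) fun x => by rw [sq, abs_mul]) hU hU fun x => abs_mul_sq_le _ _)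
  have e : ∀ x, (‖x‖ ^ 2 + 2 * x 0 ^ 2) * u x ^ 2 = ‖x‖ ^ 2 * u x ^ 2 + 2 * (x 0 ^ 2 * u x ^ 2) := fun x => by ring
  simp_rw [e]
  rw [integral_add iX (i0.const_mul 2), integral_const_mul]

include hu hB hf in
/-- **(W) The weighted identity**:
`∫ (H̃u)|x|²u = −∫|x|²|∇u|² + 2∫u² + ½∫|x|²u² − λ∫x₀²u² − ∫(κ|x|² + δx₀²)|x|²u²`. [folklore] -/
theorem oddAttenuation_weighted_identity :
    ∫ x, f x * (‖x‖ ^ 2 * u x) =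
      -(∫ x, ‖x‖ ^ 2 * (fderiv ℝ u x (EuclideanSpace.single 0 1) ^ 2 +
        fderiv ℝ u x (EuclideanSpace.single 1 1) ^ 2)) + 2 * (∫ x, u x ^ 2) +
      1 / 2 * (∫ x, ‖x‖ ^ 2 * u x ^ 2) - lam * (∫ x, x 0 ^ 2 * u x ^ 2) -
      ∫ x, (κ * ‖x‖ ^ 2 + δ * x 0 ^ 2) * (‖x‖ ^ 2 * u x ^ 2) := by
  have hU := gaussDecay_self hB
  have e1 : ∀ x, f x * (‖x‖ ^ 2 * u x) =
      ‖x‖ ^ 2 * u x * Δ u x + lam * (x 0 * ‖x‖ ^ 2 * u x * fderiv ℝ u x (EuclideanSpace.single 0 1)) -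
      (κ * ‖x‖ ^ 2 + δ * x 0 ^ 2) * (‖x‖ ^ 2 * u x ^ 2) + (1 + lam) / 2 * (‖x‖ ^ 2 * u x ^ 2) -
      R * (‖x‖ ^ 2 * ((8 * Real.pi)⁻¹ * burgersPhi (‖x‖ ^ 2 / 4)) * u x * fderiv ℝ u x (perp x)) := by
    intro x; rw [hf]; ring
  have hlap : ∀ x, Δ u x = fderiv ℝ (fderiv ℝ u) x (EuclideanSpace.single 0 1) (EuclideanSpace.single 0 1) +
      fderiv ℝ (fderiv ℝ u) x (EuclideanSpace.single 1 1) (EuclideanSpace.single 1 1) := fun x => by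
    rw [laplacian_eq_sum_fderiv_fderiv (EuclideanSpace.basisFun (Fin 2) ℝ) hu x, Fin.sum_univ_two,
      EuclideanSpace.basisFun_apply, EuclideanSpace.basisFun_apply, fderiv_partialDeriv_apply hu,
      fderiv_partialDeriv_apply hu]
  have iA : Integrable fun x => ‖x‖ ^ 2 * u x * Δ u x := by
    have e : (fun x => ‖x‖ ^ 2 * u x * Δ u x) = fun x =>
        ‖x‖ ^ 2 * u x * fderiv ℝ (fderiv ℝ u) x (EuclideanSpace.single 0 1) (EuclideanSpace.single 0 1) +
        ‖x‖ ^ 2 * u x * fderiv ℝ (fderiv ℝ u) x (EuclideanSpace.single 1 1) (EuclideanSpace.single 1 1) := by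
      funext x; rw [hlap]; ring
    rw [e]
    refine Integrable.add ?_ ?_ <;>
      exact integrable_of_gaussDecay (by norm_num)
        (((continuous_norm.pow 2).mul hu.continuous).mul (continuous_fderiv_fderiv_apply_of_contDiff_two hu _ _))
        (gaussDecay_of_le_poly_mul_mul polyBound_norm_sq hU (gaussDecay_fderiv_fderiv_apply hB _ _)
          fun x => by rw [abs_mul, abs_mul])
  have iB : Integrable fun x => x 0 * ‖x‖ ^ 2 * u x * fderiv ℝ u x (EuclideanSpace.single 0 1) :=
    integrable_of_gaussDecay (by norm_num)
      ((((contDiff_coord 0 (n := 0)).continuous.mul (continuous_norm.pow 2)).mul hu.continuous).mul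
        (continuous_fderiv_apply_of_contDiff_two hu _))
      (gaussDecay_of_le_poly_mul_mul (polyBound_of_le_mul (polyBound_coord 0) polyBound_norm_sq
        (H := fun x => x 0 * ‖x‖ ^ 2) fun x => (abs_mul _ _).le) hU (gaussDecay_fderiv_apply hB _)
        fun x => by rw [abs_mul, abs_mul])
  have hVp : ∃ (C : ℝ) (N : ℕ), ∀ x : EuclideanSpace ℝ (Fin 2),
      |(κ * ‖x‖ ^ 2 + δ * x 0 ^ 2) * ‖x‖ ^ 2| ≤ C * (1 + ‖x‖) ^ N :=
    polyBound_of_le_mul (polyBound_of_le_add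
      (polyBound_of_le_mul (polyBound_const κ) polyBound_norm_sq (H := fun x => κ * ‖x‖ ^ 2)
        fun x => (abs_mul _ _).le)
      (polyBound_of_le_mul (polyBound_const δ) (polyBound_of_le_mul (polyBound_coord 0) (polyBound_coord 0)
        (H := fun x => x 0 ^ 2) fun x => by rw [sq, abs_mul]) (H := fun x => δ * x 0 ^ 2)
        fun x => (abs_mul _ _).le)
      fun x => abs_add_le _ _) polyBound_norm_sq fun x => (abs_mul _ _).le
  have iC : Integrable fun x => (κ * ‖x‖ ^ 2 + δ * x 0 ^ 2) * (‖x‖ ^ 2 * u x ^ 2) :=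
    integrable_of_gaussDecay (by norm_num)
      ((((continuous_const.mul (continuous_norm.pow 2)).add
        (continuous_const.mul ((contDiff_coord 0 (n := 0)).continuous.pow 2))).mul
        ((continuous_norm.pow 2).mul (hu.continuous.pow 2))))
      (gaussDecay_of_le_poly_mul_mul hVp hU hU fun x => by
        rw [← mul_assoc]; exact abs_mul_sq_le _ _)
  have iD : Integrable fun x => ‖x‖ ^ 2 * u x ^ 2 :=
    integrable_of_gaussDecay (by norm_num) ((continuous_norm.pow 2).mul (hu.continuous.pow 2))
      (gaussDecay_of_le_poly_mul_mul polyBound_norm_sq hU hU fun x => abs_mul_sq_le _ _)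
  have iE : Integrable fun x =>
      ‖x‖ ^ 2 * ((8 * Real.pi)⁻¹ * burgersPhi (‖x‖ ^ 2 / 4)) * u x * fderiv ℝ u x (perp x) :=
    integrable_of_gaussDecay (by norm_num)
      ((((continuous_norm.pow 2).mul (contDiff_omega (n := 0)).continuous).mul hu.continuous).mul
        (continuous_fderiv_perp_of_contDiff_two hu))
      (gaussDecay_of_le_poly_mul_mul (polyBound_of_le_mul polyBound_norm_sq polyBound_omega
        fun x => (abs_mul _ _).le) hU (gaussDecay_fderiv_perp hB) fun x => by rw [abs_mul, abs_mul])
  have iB' : Integrable fun x => lam * (x 0 * ‖x‖ ^ 2 * u x * fderiv ℝ u x (EuclideanSpace.single 0 1)) :=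
    iB.const_mul lam
  have iD' : Integrable fun x => (1 + lam) / 2 * (‖x‖ ^ 2 * u x ^ 2) := iD.const_mul _
  have iE' : Integrable fun x =>
      R * (‖x‖ ^ 2 * ((8 * Real.pi)⁻¹ * burgersPhi (‖x‖ ^ 2 / 4)) * u x * fderiv ℝ u x (perp x)) :=
    iE.const_mul R
  have i2 : Integrable fun x => ‖x‖ ^ 2 * u x * Δ u x +
      lam * (x 0 * ‖x‖ ^ 2 * u x * fderiv ℝ u x (EuclideanSpace.single 0 1)) := iA.add iB'
  have i3 : Integrable fun x => ‖x‖ ^ 2 * u x * Δ u x +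
      lam * (x 0 * ‖x‖ ^ 2 * u x * fderiv ℝ u x (EuclideanSpace.single 0 1)) -
      (κ * ‖x‖ ^ 2 + δ * x 0 ^ 2) * (‖x‖ ^ 2 * u x ^ 2) := i2.sub iC
  have i4 : Integrable fun x => ‖x‖ ^ 2 * u x * Δ u x +
      lam * (x 0 * ‖x‖ ^ 2 * u x * fderiv ℝ u x (EuclideanSpace.single 0 1)) -
      (κ * ‖x‖ ^ 2 + δ * x 0 ^ 2) * (‖x‖ ^ 2 * u x ^ 2) + (1 + lam) / 2 * (‖x‖ ^ 2 * u x ^ 2) := i3.add iD'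
  simp_rw [e1]
  rw [integral_sub i4 iE', integral_add i3 iD', integral_sub i2 iC, integral_add iA iB',
    integral_const_mul, integral_const_mul, integral_const_mul,
    integral_norm_sq_mul_mul_laplacian_eq hu hB, integral_coord_norm_sq_mul_mul_fderiv_eq hu hB,
    integral_norm_sq_omega_mul_mul_fderiv_perp_eq_zero hu hB]
  ring

include hu hB hf hfc hfB in
/-- **(W′) The weighted estimate**: `∫|x|²|∇u|² ≤ (∫(H̃u)²)/(4κ) + 2∫u² + ½∫|x|²u²`
(`κ > 0`, `λ, δ ≥ 0`). [folklore] -/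
theorem oddAttenuation_weighted_estimate (hκ : 0 < κ) (hlam : 0 ≤ lam) (hδ : 0 ≤ δ) :
    ∫ x, ‖x‖ ^ 2 * (fderiv ℝ u x (EuclideanSpace.single 0 1) ^ 2 +
        fderiv ℝ u x (EuclideanSpace.single 1 1) ^ 2) ≤
      (∫ x, f x ^ 2) / (4 * κ) + 2 * (∫ x, u x ^ 2) + 1 / 2 * ∫ x, ‖x‖ ^ 2 * u x ^ 2 := by
  have hid := oddAttenuation_weighted_identity hu hB hf
  have hU := gaussDecay_self hB
  -- Cauchy–Schwarz against `|x|² u`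
  have if2 : Integrable fun x => f x ^ 2 :=
    integrable_of_gaussDecay (by norm_num) (hfc.pow 2)
      (gaussDecay_of_le_poly_mul_mul (polyBound_const 1) hfB hfB fun x => abs_sq_le_one_mul _)
  have hP4 : ∃ (C : ℝ) (N : ℕ), ∀ x : EuclideanSpace ℝ (Fin 2), |‖x‖ ^ 2 * ‖x‖ ^ 2| ≤ C * (1 + ‖x‖) ^ N :=
    polyBound_of_le_mul polyBound_norm_sq polyBound_norm_sq fun x => (abs_mul _ _).le
  have iY : Integrable fun x => (‖x‖ ^ 2 * u x) ^ 2 :=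
    integrable_of_gaussDecay (by norm_num) (((continuous_norm.pow 2).mul hu.continuous).pow 2)
      (gaussDecay_of_le_poly_mul_mul hP4 hU hU fun x =>
        le_of_eq (by rw [← abs_mul, ← abs_mul]; exact congr_arg _ (by ring)))
  have ifY : Integrable fun x => f x * (‖x‖ ^ 2 * u x) :=
    integrable_of_gaussDecay (by norm_num) (hfc.mul ((continuous_norm.pow 2).mul hu.continuous))
      (gaussDecay_of_le_poly_mul_mul polyBound_norm_sq hfB hU fun x =>
        le_of_eq (by rw [← abs_mul, ← abs_mul]; exact congr_arg _ (by ring)))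
  have hCS := abs_integral_mul_le_sqrt_mul_sqrt if2 iY ifY
  -- `κ ∫ |x|⁴u² ≤ ∫ V |x|² u²`
  have hVp : ∃ (C : ℝ) (N : ℕ), ∀ x : EuclideanSpace ℝ (Fin 2),
      |(κ * ‖x‖ ^ 2 + δ * x 0 ^ 2) * ‖x‖ ^ 2| ≤ C * (1 + ‖x‖) ^ N :=
    polyBound_of_le_mul (polyBound_of_le_add
      (polyBound_of_le_mul (polyBound_const κ) polyBound_norm_sq (H := fun x => κ * ‖x‖ ^ 2)
        fun x => (abs_mul _ _).le)
      (polyBound_of_le_mul (polyBound_const δ) (polyBound_of_le_mul (polyBound_coord 0) (polyBound_coord 0)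
        (H := fun x => x 0 ^ 2) fun x => by rw [sq, abs_mul]) (H := fun x => δ * x 0 ^ 2)
        fun x => (abs_mul _ _).le)
      fun x => abs_add_le _ _) polyBound_norm_sq fun x => (abs_mul _ _).le
  have iC : Integrable fun x => (κ * ‖x‖ ^ 2 + δ * x 0 ^ 2) * (‖x‖ ^ 2 * u x ^ 2) :=
    integrable_of_gaussDecay (by norm_num)
      ((((continuous_const.mul (continuous_norm.pow 2)).add
        (continuous_const.mul ((contDiff_coord 0 (n := 0)).continuous.pow 2))).mul
        ((continuous_norm.pow 2).mul (hu.continuous.pow 2))))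
      (gaussDecay_of_le_poly_mul_mul hVp hU hU fun x => by
        rw [← mul_assoc]; exact abs_mul_sq_le _ _)
  have hVY : κ * ∫ x, (‖x‖ ^ 2 * u x) ^ 2 ≤ ∫ x, (κ * ‖x‖ ^ 2 + δ * x 0 ^ 2) * (‖x‖ ^ 2 * u x ^ 2) := by
    rw [← integral_const_mul]
    refine integral_mono (iY.const_mul κ) iC fun x => ?_
    dsimp only
    nlinarith [mul_nonneg (mul_nonneg hδ (sq_nonneg (x 0))) (mul_nonneg (sq_nonneg ‖x‖) (sq_nonneg (u x)))]
  have h0 : 0 ≤ ∫ x, x 0 ^ 2 * u x ^ 2 := integral_nonneg fun x => by positivity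
  have hq0 : 0 ≤ ∫ x, f x ^ 2 := integral_nonneg fun x => by positivity
  have hY0 : 0 ≤ ∫ x, (‖x‖ ^ 2 * u x) ^ 2 := integral_nonneg fun x => by positivity
  -- `√q √Y − κ Y ≤ q/(4κ)`
  have hsq := Real.sq_sqrt hq0
  have hsY := Real.sq_sqrt hY0
  have hab : Real.sqrt (∫ x, f x ^ 2) * Real.sqrt (∫ x, (‖x‖ ^ 2 * u x) ^ 2) - κ * ∫ x, (‖x‖ ^ 2 * u x) ^ 2 ≤
      (∫ x, f x ^ 2) / (4 * κ) := by
    rw [le_div_iff₀ (by positivity)]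
    have h1 : κ ^ 2 * Real.sqrt (∫ x, (‖x‖ ^ 2 * u x) ^ 2) ^ 2 = κ ^ 2 * ∫ x, (‖x‖ ^ 2 * u x) ^ 2 := by
      rw [hsY]
    nlinarith [sq_nonneg (Real.sqrt (∫ x, f x ^ 2) - 2 * κ * Real.sqrt (∫ x, (‖x‖ ^ 2 * u x) ^ 2))]
  have hfu : -(∫ x, f x * (‖x‖ ^ 2 * u x)) ≤
      Real.sqrt (∫ x, f x ^ 2) * Real.sqrt (∫ x, (‖x‖ ^ 2 * u x) ^ 2) := (neg_le_abs _).trans hCS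
  have hx0 : 0 ≤ lam * ∫ x, x 0 ^ 2 * u x ^ 2 := mul_nonneg hlam h0
  linarith [hid, hfu, hVY, hab, hx0]

end Weighted

/-- Registered tools stub of crux stmt-NavierStokesRegularity-17973 (`stub_oddAttenuationToolsE`):
the weighted identity and the weighted estimate of the conjugated local operator. [folklore] -/
theorem stub_oddAttenuationToolsE :
    ∀ (u : EuclideanSpace ℝ (Fin 2) → ℝ), ContDiff ℝ 2 u →
      (∃ (C : ℝ) (N : ℕ), ∀ x, |u x| ≤ C * (1 + ‖x‖) ^ N * Real.exp (-(1 / 8 * ‖x‖ ^ 2)) ∧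
        ‖fderiv ℝ u x‖ ≤ C * (1 + ‖x‖) ^ N * Real.exp (-(1 / 8 * ‖x‖ ^ 2)) ∧
        ‖fderiv ℝ (fderiv ℝ u) x‖ ≤ C * (1 + ‖x‖) ^ N * Real.exp (-(1 / 8 * ‖x‖ ^ 2))) →
      ∀ (lam κ δ R : ℝ) (f : EuclideanSpace ℝ (Fin 2) → ℝ),
      (∀ x, f x = Δ u x + lam * x 0 * fderiv ℝ u x (EuclideanSpace.single 0 1) -
        (κ * ‖x‖ ^ 2 + δ * x 0 ^ 2) * u x + (1 + lam) / 2 * u x -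
        R * ((8 * Real.pi)⁻¹ * burgersPhi (‖x‖ ^ 2 / 4) * fderiv ℝ u x (perp x))) →
      (∫ x, f x * (‖x‖ ^ 2 * u x) =
        -(∫ x, ‖x‖ ^ 2 * (fderiv ℝ u x (EuclideanSpace.single 0 1) ^ 2 +
          fderiv ℝ u x (EuclideanSpace.single 1 1) ^ 2)) + 2 * (∫ x, u x ^ 2) +
        1 / 2 * (∫ x, ‖x‖ ^ 2 * u x ^ 2) - lam * (∫ x, x 0 ^ 2 * u x ^ 2) -
        ∫ x, (κ * ‖x‖ ^ 2 + δ * x 0 ^ 2) * (‖x‖ ^ 2 * u x ^ 2)) ∧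
      (Continuous f →
        (∃ (C : ℝ) (N : ℕ), ∀ x, |f x| ≤ C * (1 + ‖x‖) ^ N * Real.exp (-(1 / 8 * ‖x‖ ^ 2))) →
        0 < κ → 0 ≤ lam → 0 ≤ δ →
        ∫ x, ‖x‖ ^ 2 * (fderiv ℝ u x (EuclideanSpace.single 0 1) ^ 2 +
            fderiv ℝ u x (EuclideanSpace.single 1 1) ^ 2) ≤
          (∫ x, f x ^ 2) / (4 * κ) + 2 * (∫ x, u x ^ 2) + 1 / 2 * ∫ x, ‖x‖ ^ 2 * u x ^ 2) :=
  fun _ hu hB _ _ _ _ _ hf =>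
    ⟨oddAttenuation_weighted_identity hu hB hf,
      fun hfc hfB hκ hlam hδ => oddAttenuation_weighted_estimate hu hB hf hfc hfB hκ hlam hδ⟩

end Summit.NavierStokesRegularity.NavierStokesRegularity.Theorems
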